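import Summits.BirchSwinnertonDyer.BirchSwinnertonDyer.Theorems.PrintX11aUpperNonSurjThreeSharpLayer
import Summits.BirchSwinnertonDyer.BirchSwinnertonDyer.Theorems.PrintX11aUpperNonSurjThreeSharpDescent
import Literature.NumberTheory.EllipticCurves.IwasawaSelmerControlCokerProofs
import Literature.NumberTheory.EllipticCurves.KatoFineSelmerFiniteProofs
import Literature.NumberTheory.EllipticCurves.FineSelmerTorsionCoefficientsFiniteProofs
import HarnessLib

/-!
# Route `PrintX11a`, child crux U3 = `PrintX11a.UpperNonSurjThree` (item stmt-BirchSwinnertonDyer-20613),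
# line «finemu3», stub `FineMu.stub_conjA_three` — ♯δ WITH THE LAYER DESCENT, PROVED: the layer-`n` certificate becomes
# a count of LEVEL-`n` classes — «fewer than `p^{pⁿ}` classes of `H¹(ℚ_n, E[p])` restrict into `Sel₀(ℚ_∞, E[p^∞])`» ⟹
# statement (A) — using the tree's Greenberg Lemma 3.2 at the layers (`ZpExtension.mem_range_resOfLe_of_conjH1_eq`)
# (cell `bsd-print-x11a`, width seat `bsd-line-x11a-p1-w2`; closes the `TODO(layer descent)` of `…SharpLayer`;
# `--supports` 20613; closes nothing)

HONEST FRAMING.  BSD is not proved by any of this; nothing is asserted about any curve; the crux and its stub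
`stub_conjA_three` stay OPEN.  THEOREMS ONLY (no definition, no named fact, no `sorry`), all PROVED from tree theorems.

WHAT.  `…SharpLayer` (p609663) proved «`#Sel₀(ℚ_∞, E[p^∞])[p]^{γ^{pⁿ}} < p^{pⁿ} ⟹ Sel₀[p]` finite ⟹ (A)» and left the
identification of that `Γ_n`-fixed set with a LEVEL-`n` object as a paper step.  The tree already holds Greenberg's
Lemma 3.2 at every layer, for every discrete `p`-primary module with continuous orbit maps and every `ℤ_p`-datum:
`ZpExtension.mem_range_resOfLe_of_conjH1_eq` («`res : H¹(Gal(K̄/K_n), M) → H¹(Gal(K̄/K_∞), M)` hits every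
`conj_{γ^{pⁿ}}`-fixed class», `IwasawaSelmerControlCokerProofs`, proved on cocycles).  With the injectivity of
`E[p] ↪ E[p^∞]` on `H¹(ℚ_∞, ·)` for `E[p]` irreducible and `ρ̄` not onto (`…SharpDescent` §1–§2) this gives:

* §1 `natCard_layerFixed_le`: for `E/ℚ` with `Irr ∧ ¬Surj`, any cyclotomic… in fact ANY `ℤ_p`-datum `κ`, top
  generator `γ`, layer `n`: the `p`-torsion classes of `Sel₀(ℚ_∞, E[p^∞])` fixed by `conj_{γ^{pⁿ}}` all lie in the image
  of `Y_n(κ) := {y ∈ H¹(Gal(ℚ̄/ℚ_n), E[p]) : ι(res_{ℚ_∞} y) ∈ Sel₀(ℚ_∞, E[p^∞])}` (`subgroupH1 (κ.layerSubgroup n)`), so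
  they are at most `#Y_n(κ)` in number when `Y_n(κ)` is finite.
* §2 **`conjAAt_of_irr_of_not_surj_of_forall_natCard_layerResidual_lt`**: if for every cyclotomic `κ`, `Y_n(κ)` is
  finite with `#Y_n(κ) < p^{pⁿ}`, then statement (A) `Rank1Residual.ConjAAt W p` — a certificate quantified over
  LEVEL-`n` classes only (`n = 1`: the first layer `ℚ₁`, the line card's ♯δ; `n = 0`: a counting form of ♯0).
* §3 the level-`n` classes of `Y_n(κ)` UNPACKED locally as in `…SharpLocal`: each is unramified at every prime
  `𝔓 ∤ S·p` (`resOfLe (I_𝔓 ≤ Gal(ℚ̄/ℚ_n)) y = 0`) and satisfies the local ♯-condition at every finite place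
  (`ι_v(res_{Gal(ℚ̄/ℚ_∞) ⊓ D_v} y) = 0`); hence the door from the LOCAL level-`n` certificate
  `R♭_n(E,p) := {y ∈ H¹(G_{ℚ_n}, E[p]; S) : loc ∈ B_v}`, `#R♭_n < p^{pⁿ}`; §4 the doors on `ClassX11a ∧ ¬Surj`.

What stays on paper for an engine: as for ♯0 (REF V14) only the explicit formulae for the local groups `B_v` at
`v ∈ S` (Tate curve at `p`, unramified `ℤ_p`-tower at bad `v ≠ p`); the global descent is now entirely in the kernel.

References: [GreenbergLNM1716] §3 Lemma 3.2 («`Coker(h_n) = 0`»), Lemmas 3.1, 3.3; [SerreGaloisCohomology1997] I.§2.6 (b),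
I.§3.4; [CoatesSujatha2005] §3 statement (A); [Lang1990] Ch. 13 §1 Lemma 3; line card Lines/finemu3.md (P2) ♯δ.
-/

set_option linter.dupNamespace false
set_option autoImplicit false

noncomputable section

open scoped Classical

open WeierstrassCurve Field NumberField IsDedekindDomain
  Literature.NumberTheory.EllipticCurves
  Literature.NumberTheory.EllipticCurves.GreenbergSelmer
  Literature.NumberTheory.EllipticCurves.Castella2018
  Literature.NumberTheory.EllipticCurves.Rank1Residual
  Literature.NumberTheory.GaloisRepresentations
  Summit.BirchSwinnertonDyer.Rank1Residual

namespace Summit.BirchSwinnertonDyer.BirchSwinnertonDyer.Theorems.UpperNonSurjThreeSharp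

/-! ### §1 `Sel₀[p]^{γ^{pⁿ}}` is covered by the level-`n` classes restricting into `Sel₀` -/

section Cover

variable (W : WeierstrassCurve ℚ) [W.IsElliptic] (p : ℕ) [Fact p.Prime]

/-- **Every `conj_{γ^{pⁿ}}`-fixed `p`-torsion class of `Sel₀(ℚ_∞, E[p^∞])` comes from a level-`n` class**: for `E/ℚ`
with `E[p]` irreducible and `ρ̄` not onto, any `ℤ_p`-datum `κ` with top generator `γ`, such a class is `ι(res_{ℚ_∞} y)`
for some `y ∈ H¹(Gal(ℚ̄/ℚ_n), E[p])` with `ι(res y) ∈ Sel₀`.  Kummer lift (`exists_torsionToPrimaryH1Sub_eq`), `ι`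
injective (`…SharpDescent`), Greenberg Lemma 3.2 at layer `n` (`ZpExtension.mem_range_resOfLe_of_conjH1_eq`).
PROVED, no named fact. [cite: GreenbergLNM1716, §3 Lemmas 3.1–3.2] -/
theorem layerFixed_subset_range (hirr : W.HasIrreducibleModPGaloisRep p)
    (hns : ¬ W.HasSurjectiveModNGaloisRep p) (κ : ZpExtension ℚ p) {γ : absoluteGaloisGroup ℚ}
    (hγ : κ.IsTopGenerator γ) (n : ℕ) :
    {s : W.fineSelmerInfty κ |
        p • s = 0 ∧ W.conjH1 p κ.kerSubgroup (γ ^ p ^ n) (s : W.subgroupH1 p κ.kerSubgroup) = s} ⊆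
      Set.range (fun y : {y : subgroupH1 (κ.layerSubgroup n) (geomTorsion W (p : ℤ)) |
          W.torsionToPrimaryH1Sub p κ.kerSubgroup
            (resOfLe (geomTorsion W (p : ℤ)) (κ.kerSubgroup_le_layerSubgroup n) y) ∈ W.fineSelmerInfty κ} ↦
        (⟨W.torsionToPrimaryH1Sub p κ.kerSubgroup
            (resOfLe (geomTorsion W (p : ℤ)) (κ.kerSubgroup_le_layerSubgroup n) y.1), y.2⟩ :
          W.fineSelmerInfty κ)) := by
  have hp : p.Prime := Fact.out
  haveI : Finite (geomTorsion W (p : ℤ)) :=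
    finite_torsionPoints_holds W (AlgebraicClosure ℚ) (by exact_mod_cast hp.ne_zero)
  haveI : ContinuousSMul (absoluteGaloisGroup ℚ) (geomTorsion W (p : ℤ)) :=
    continuousSMul_geomTorsion W (isOpen_stabilizer_point_holds W) _
  have hcont : ∀ m : geomTorsion W (p : ℤ), Continuous fun g : absoluteGaloisGroup ℚ ↦ g • m :=
    fun _ ↦ continuous_id.smul continuous_const
  have hprim : ∀ m : geomTorsion W (p : ℤ), ∃ k : ℕ, p ^ k • m = 0 :=
    fun m ↦ ⟨1, by rw [pow_one]; exact AddSubgroup.torsionBy.nsmul m⟩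
  rintro s ⟨hps, hfix⟩
  have hps' : p • (s : W.subgroupH1 p κ.kerSubgroup) = 0 := by
    rw [← AddSubgroupClass.coe_nsmul, hps]; rfl
  -- Kummer lift and `γ^{pⁿ}`-invariance of the lift
  obtain ⟨x, hx⟩ := W.exists_torsionToPrimaryH1Sub_eq p (H := κ.kerSubgroup)
    W.zsmul_geomPoints_surjective_holds hps'
  have hinj := torsionToPrimaryH1Sub_injective_of_fixedPoints_eq_zero W p κ.kerSubgroup
    (geomPrimaryTorsion_kerSubgroup_fixed_eq_zero W p hirr hns κ)
  have hxfix : conjH1 κ.kerSubgroup (geomTorsion W (p : ℤ)) (γ ^ p ^ n) x = x := by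
    apply hinj
    rw [← conjH1_torsionToPrimaryH1Sub, hx, hfix]
  -- Greenberg's Lemma 3.2 at layer `n`
  obtain ⟨y, hy⟩ := (AddMonoidHom.mem_range).mp
    (ZpExtension.mem_range_resOfLe_of_conjH1_eq κ hγ n hcont hprim x hxfix)
  have hmem : W.torsionToPrimaryH1Sub p κ.kerSubgroup
      (resOfLe (geomTorsion W (p : ℤ)) (κ.kerSubgroup_le_layerSubgroup n) y) ∈ W.fineSelmerInfty κ := by
    rw [hy, hx]; exact s.2
  exact ⟨⟨y, hmem⟩, Subtype.ext (by simp only [hy, hx])⟩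

/-- **Counting form**: if `Y_n(κ) = {y ∈ H¹(Gal(ℚ̄/ℚ_n), E[p]) : ι(res y) ∈ Sel₀}` is finite then the `conj_{γ^{pⁿ}}`-fixed
`p`-torsion of `Sel₀(ℚ_∞, E[p^∞])` is finite and at most `#Y_n(κ)` in number.  PROVED.
[cite: GreenbergLNM1716, §3 Lemma 3.2] -/
theorem finite_and_natCard_layerFixed_le (hirr : W.HasIrreducibleModPGaloisRep p)
    (hns : ¬ W.HasSurjectiveModNGaloisRep p) (κ : ZpExtension ℚ p) {γ : absoluteGaloisGroup ℚ}
    (hγ : κ.IsTopGenerator γ) (n : ℕ)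
    (hY : Set.Finite {y : subgroupH1 (κ.layerSubgroup n) (geomTorsion W (p : ℤ)) |
      W.torsionToPrimaryH1Sub p κ.kerSubgroup
        (resOfLe (geomTorsion W (p : ℤ)) (κ.kerSubgroup_le_layerSubgroup n) y) ∈ W.fineSelmerInfty κ}) :
    Set.Finite {s : W.fineSelmerInfty κ |
        p • s = 0 ∧ W.conjH1 p κ.kerSubgroup (γ ^ p ^ n) (s : W.subgroupH1 p κ.kerSubgroup) = s} ∧
      Nat.card {s : W.fineSelmerInfty κ |
          p • s = 0 ∧ W.conjH1 p κ.kerSubgroup (γ ^ p ^ n) (s : W.subgroupH1 p κ.kerSubgroup) = s} ≤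
        Nat.card {y : subgroupH1 (κ.layerSubgroup n) (geomTorsion W (p : ℤ)) |
          W.torsionToPrimaryH1Sub p κ.kerSubgroup
            (resOfLe (geomTorsion W (p : ℤ)) (κ.kerSubgroup_le_layerSubgroup n) y) ∈ W.fineSelmerInfty κ} := by
  have hsub := layerFixed_subset_range W p hirr hns κ hγ n
  haveI := hY.to_subtype
  have hrange := Set.finite_range (fun y : {y : subgroupH1 (κ.layerSubgroup n) (geomTorsion W (p : ℤ)) |
      W.torsionToPrimaryH1Sub p κ.kerSubgroup
        (resOfLe (geomTorsion W (p : ℤ)) (κ.kerSubgroup_le_layerSubgroup n) y) ∈ W.fineSelmerInfty κ} ↦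
    (⟨W.torsionToPrimaryH1Sub p κ.kerSubgroup
        (resOfLe (geomTorsion W (p : ℤ)) (κ.kerSubgroup_le_layerSubgroup n) y.1), y.2⟩ : W.fineSelmerInfty κ))
  exact ⟨hrange.subset hsub, (Nat.card_mono hrange hsub).trans (Finite.card_range_le _)⟩

end Cover

/-! ### §2 Statement (A) from the LEVEL-`n` count -/

section OverQ

variable (W : WeierstrassCurve ℚ) [W.IsElliptic] (p : ℕ) [Fact p.Prime]

/-- **♯δ WITH DESCENT — statement (A) from a count of LEVEL-`n` classes.**  For `E/ℚ` with `E[p]` irreducible and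
`ρ̄_{E,p}` not surjective: if for every cyclotomic `ℤ_p`-datum `κ` the set
`Y_n(κ) = {y ∈ H¹(Gal(ℚ̄/ℚ_n), E[p]) : ι(res_{ℚ_∞} y) ∈ Sel₀(ℚ_∞, E[p^∞])}` is finite with `#Y_n(κ) < p^{pⁿ}`, then
Coates–Sujatha's statement (A) holds at the pair (`Rank1Residual.ConjAAt W p`).  `n = 1` is the line card's ♯δ
(«`dim_{𝔽_p} R♯(E/ℚ₁, p) ≤ p − 1`» in counting form); `n = 0` a counting form of ♯0.  PROVED, no named fact; (A)
asserted for no curve. [cite: CoatesSujatha2005, §3 statement (A)] [cite: GreenbergLNM1716, §3 Lemma 3.2]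
[cite: Lang1990, Ch. 13 §1 Lemma 3] -/
theorem conjAAt_of_irr_of_not_surj_of_forall_natCard_layerResidual_lt (hirr : W.HasIrreducibleModPGaloisRep p)
    (hns : ¬ W.HasSurjectiveModNGaloisRep p) (n : ℕ)
    (h : ∀ κ : ZpExtension ℚ p, κ.IsCyclotomic →
      Set.Finite {y : subgroupH1 (κ.layerSubgroup n) (geomTorsion W (p : ℤ)) |
          W.torsionToPrimaryH1Sub p κ.kerSubgroup
            (resOfLe (geomTorsion W (p : ℤ)) (κ.kerSubgroup_le_layerSubgroup n) y) ∈ W.fineSelmerInfty κ} ∧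
        Nat.card {y : subgroupH1 (κ.layerSubgroup n) (geomTorsion W (p : ℤ)) |
          W.torsionToPrimaryH1Sub p κ.kerSubgroup
            (resOfLe (geomTorsion W (p : ℤ)) (κ.kerSubgroup_le_layerSubgroup n) y) ∈ W.fineSelmerInfty κ} <
          p ^ p ^ n) :
    ConjAAt W p := by
  intro κ hκ
  obtain ⟨γ, hγ⟩ : ∃ γ : absoluteGaloisGroup ℚ, κ.IsTopGenerator γ := κ.surjective (Multiplicative.ofAdd 1)
  obtain ⟨hYfin, hYlt⟩ := h κ hκ
  obtain ⟨hFfin, hle⟩ := finite_and_natCard_layerFixed_le W p hirr hns κ hγ n hYfin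
  exact exists_fineSelmerDualData_moduleFinite_of_natCard_layer_lt W κ hγ n hFfin (lt_of_le_of_lt hle hYlt)

end OverQ

/-! ### §3 The level-`n` classes of `Y_n(κ)` unpacked: unramified outside `S·p`, locally ♯-trivial everywhere -/

section Unpack

universe u

variable {K : Type} [Field K] [NumberField K] (W : WeierstrassCurve K) [W.IsElliptic] {p : ℕ} [Fact p.Prime]
  (κ : ZpExtension K p) (n : ℕ)

/-- **(a)ₙ Unramified outside `S`.**  For a CYCLOTOMIC `κ` and a level-`n` class `y ∈ H¹(Gal(K̄/K_n), E[p])` with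
`ι(res_{K_∞} y) ∈ Sel₀(K_∞, E[p^∞])`: `y` restricts to `0` on the inertia group of every prime `𝔓` of `\bar ℤ_K` above a
place `v` of good reduction, `v ∤ p` (`I_𝔓 ≤ Gal(K̄/K_∞) ≤ Gal(K̄/K_n)`; awayKer + Silverman X.4.4 as in `…SharpLocal`).
[cite: SilvermanAEC2009, Cor. X.4.4] [cite: Greenberg1989, §1 p. 98] [cite: Washington1997, §13.1] -/
theorem resOfLe_inertia_eq_zero_of_layer_mem_fineSelmerInfty (hκ : κ.IsCyclotomic)
    (y : subgroupH1 (κ.layerSubgroup n) (geomTorsion W (p : ℤ)))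
    (hy : W.torsionToPrimaryH1Sub p κ.kerSubgroup
      (resOfLe (geomTorsion W (p : ℤ)) (κ.kerSubgroup_le_layerSubgroup n) y) ∈ W.fineSelmerInfty κ)
    {v : HeightOneSpectrum (𝓞 K)} (hv : v ∉ W.badPlaces (𝓞 K)) (hpv : (p : 𝓞 K) ∉ v.asIdeal)
    {𝔓 : Ideal (absIntegers (𝓞 K) K)} (h𝔓 : 𝔓 ∈ v.primesAbove) :
    resOfLe (geomTorsion W (p : ℤ))
      ((ZpExtension.IsCyclotomic.inertia_le_kerSubgroup hκ hpv h𝔓).trans (κ.kerSubgroup_le_layerSubgroup n)) y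
        = 0 := by
  have hle : 𝔓.inertia (absoluteGaloisGroup K) ≤ κ.kerSubgroup :=
    ZpExtension.IsCyclotomic.inertia_le_kerSubgroup hκ hpv h𝔓
  have hpv₀ : ((p : ℕ) : 𝓞 K) ∉ v.asIdeal := hpv
  have hy' := (mem_strictSelmerGroupOver_iff
    (W.torsionToPrimaryH1Sub p κ.kerSubgroup
      (resOfLe (geomTorsion W (p : ℤ)) (κ.kerSubgroup_le_layerSubgroup n) y))).mp hy
  have h1 : resOfLe (geomTorsion W (p : ℤ)) hle
      (resOfLe (geomTorsion W (p : ℤ)) (κ.kerSubgroup_le_layerSubgroup n) y) = 0 :=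
    AcSelmer.resOfLe_torsion_eq_zero_of_forall_conjH1_mem_awayKer (H := κ.kerSubgroup)
      (fun σ ↦ hy'.1 v hpv₀ σ) hv hpv h𝔓 hle
  rw [← AddMonoidHom.comp_apply, Literature.NumberTheory.EllipticCurves.resOfLe_comp_holds] at h1
  exact h1

omit [W.IsElliptic] in
/-- **(b)ₙ The local ♯-condition at every finite place** for a level-`n` class restricting into `Sel₀` (any `κ`):
`ι_v(res_{Gal(K̄/K_∞) ⊓ D_v} y) = 0`. [cite: GreenbergLNM1716, §3 (local conditions at the places of `F_∞`)] -/
theorem torsionToPrimaryH1Sub_resOfLe_inf_decomp_eq_zero_of_layer_mem_fineSelmerInfty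
    (y : subgroupH1 (κ.layerSubgroup n) (geomTorsion W (p : ℤ)))
    (hy : W.torsionToPrimaryH1Sub p κ.kerSubgroup
      (resOfLe (geomTorsion W (p : ℤ)) (κ.kerSubgroup_le_layerSubgroup n) y) ∈ W.fineSelmerInfty κ)
    (v : HeightOneSpectrum (𝓞 K)) :
    W.torsionToPrimaryH1Sub p (κ.kerSubgroup ⊓ decomp v)
      (resOfLe (geomTorsion W (p : ℤ))
        ((inf_le_left : κ.kerSubgroup ⊓ decomp v ≤ κ.kerSubgroup).trans (κ.kerSubgroup_le_layerSubgroup n)) y)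
        = 0 := by
  have h1 := ((FineSelmerCoefficientMap.mem_fineSelmerInfty_iff_resOfLe (M := W.geomPrimaryTorsion p) κ _).mp
    hy).1 v 1
  rw [show conjH1 κ.kerSubgroup (W.geomPrimaryTorsion p) 1 = AddMonoidHom.id _ from
      conjH1_one_holds κ.kerSubgroup (W.geomPrimaryTorsion p), AddMonoidHom.id_apply,
    FineSelmerCoefficientMap.resOfLe_torsionToPrimaryH1Sub, ← AddMonoidHom.comp_apply (resOfLe _ _),
    Literature.NumberTheory.EllipticCurves.resOfLe_comp_holds] at h1
  exact h1

end Unpack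

/-! ### §4 The door from the LOCAL level-`n` certificate, and the doors on `ClassX11a ∧ ¬Surj` -/

section Doors

variable (W : WeierstrassCurve ℚ) [W.IsElliptic] (p : ℕ) [Fact p.Prime]

/-- **Statement (A) from the LOCAL level-`n` certificate `#R♭_n(E,p) < p^{pⁿ}`**: for `E/ℚ` with `E[p]` irreducible and
`ρ̄` not onto, if for every cyclotomic `κ` the level-`n` classes `y ∈ H¹(Gal(ℚ̄/ℚ_n), E[p])` that are unramified at
every prime `𝔓` above every good `v ∤ p` AND locally ♯-trivial at every finite place are finite in number and fewer
than `p^{pⁿ}`, then (A) holds (`Y_n(κ) ⊆ R♭_n` by §3).  PROVED, no named fact; (A) asserted for no curve.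
[cite: CoatesSujatha2005, §3 statement (A)] [cite: GreenbergLNM1716, §3 Lemmas 3.1–3.3] -/
theorem conjAAt_of_irr_of_not_surj_of_forall_natCard_layerLocal_lt (hirr : W.HasIrreducibleModPGaloisRep p)
    (hns : ¬ W.HasSurjectiveModNGaloisRep p) (n : ℕ)
    (h : ∀ κ : ZpExtension ℚ p, (hκ : κ.IsCyclotomic) →
      Set.Finite {y : subgroupH1 (κ.layerSubgroup n) (geomTorsion W (p : ℤ)) |
          (∀ (v : HeightOneSpectrum (𝓞 ℚ)) (hv : v ∉ W.badPlaces (𝓞 ℚ)) (hpv : (p : 𝓞 ℚ) ∉ v.asIdeal)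
              (𝔓 : Ideal (absIntegers (𝓞 ℚ) ℚ)) (h𝔓 : 𝔓 ∈ v.primesAbove),
            resOfLe (geomTorsion W (p : ℤ))
              ((ZpExtension.IsCyclotomic.inertia_le_kerSubgroup hκ hpv h𝔓).trans
                (κ.kerSubgroup_le_layerSubgroup n)) y = 0) ∧
          ∀ v : HeightOneSpectrum (𝓞 ℚ),
            W.torsionToPrimaryH1Sub p (κ.kerSubgroup ⊓ decomp v)
              (resOfLe (geomTorsion W (p : ℤ))
                ((inf_le_left : κ.kerSubgroup ⊓ decomp v ≤ κ.kerSubgroup).trans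
                  (κ.kerSubgroup_le_layerSubgroup n)) y) = 0} ∧
        Nat.card {y : subgroupH1 (κ.layerSubgroup n) (geomTorsion W (p : ℤ)) |
          (∀ (v : HeightOneSpectrum (𝓞 ℚ)) (hv : v ∉ W.badPlaces (𝓞 ℚ)) (hpv : (p : 𝓞 ℚ) ∉ v.asIdeal)
              (𝔓 : Ideal (absIntegers (𝓞 ℚ) ℚ)) (h𝔓 : 𝔓 ∈ v.primesAbove),
            resOfLe (geomTorsion W (p : ℤ))
              ((ZpExtension.IsCyclotomic.inertia_le_kerSubgroup hκ hpv h𝔓).trans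
                (κ.kerSubgroup_le_layerSubgroup n)) y = 0) ∧
          ∀ v : HeightOneSpectrum (𝓞 ℚ),
            W.torsionToPrimaryH1Sub p (κ.kerSubgroup ⊓ decomp v)
              (resOfLe (geomTorsion W (p : ℤ))
                ((inf_le_left : κ.kerSubgroup ⊓ decomp v ≤ κ.kerSubgroup).trans
                  (κ.kerSubgroup_le_layerSubgroup n)) y) = 0} < p ^ p ^ n) :
    ConjAAt W p := by
  refine conjAAt_of_irr_of_not_surj_of_forall_natCard_layerResidual_lt W p hirr hns n fun κ hκ ↦ ?_
  obtain ⟨hfin, hlt⟩ := h κ hκ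
  have hsub : {y : subgroupH1 (κ.layerSubgroup n) (geomTorsion W (p : ℤ)) |
      W.torsionToPrimaryH1Sub p κ.kerSubgroup
        (resOfLe (geomTorsion W (p : ℤ)) (κ.kerSubgroup_le_layerSubgroup n) y) ∈ W.fineSelmerInfty κ} ⊆
      {y : subgroupH1 (κ.layerSubgroup n) (geomTorsion W (p : ℤ)) |
          (∀ (v : HeightOneSpectrum (𝓞 ℚ)) (hv : v ∉ W.badPlaces (𝓞 ℚ)) (hpv : (p : 𝓞 ℚ) ∉ v.asIdeal)
              (𝔓 : Ideal (absIntegers (𝓞 ℚ) ℚ)) (h𝔓 : 𝔓 ∈ v.primesAbove),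
            resOfLe (geomTorsion W (p : ℤ))
              ((ZpExtension.IsCyclotomic.inertia_le_kerSubgroup hκ hpv h𝔓).trans
                (κ.kerSubgroup_le_layerSubgroup n)) y = 0) ∧
          ∀ v : HeightOneSpectrum (𝓞 ℚ),
            W.torsionToPrimaryH1Sub p (κ.kerSubgroup ⊓ decomp v)
              (resOfLe (geomTorsion W (p : ℤ))
                ((inf_le_left : κ.kerSubgroup ⊓ decomp v ≤ κ.kerSubgroup).trans
                  (κ.kerSubgroup_le_layerSubgroup n)) y) = 0} := by
    intro y hy
    exact ⟨fun v hv hpv 𝔓 h𝔓 ↦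
        resOfLe_inertia_eq_zero_of_layer_mem_fineSelmerInfty W κ n hκ y hy hv hpv h𝔓,
      torsionToPrimaryH1Sub_resOfLe_inf_decomp_eq_zero_of_layer_mem_fineSelmerInfty W κ n y hy⟩
  exact ⟨hfin.subset hsub, (Nat.card_mono hfin hsub).trans_lt hlt⟩

/-- **♯δ-with-descent door on the finemu3/finemu5 domain** (`ClassX11a W p ∧ ¬ Surj W p`): the level-`n` count
`#Y_n(κ) < p^{pⁿ}` for every cyclotomic `κ` gives statement (A) at the pair.  PROVED, no named fact.
[cite: CoatesSujatha2005, §3 statement (A)] [cite: GreenbergLNM1716, §3 Lemma 3.2] -/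
theorem _root_.Summit.BirchSwinnertonDyer.Rank1Residual.ClassX11a.conjAAt_of_not_surj_of_forall_natCard_layerResidual_lt
    (W : WeierstrassCurve ℚ) [W.IsElliptic] [W.IsGloballyMinimal] (p : ℕ) [Fact p.Prime]
    (hX : ClassX11a W p) (hns : ¬ Surj W p) (n : ℕ)
    (h : ∀ κ : ZpExtension ℚ p, κ.IsCyclotomic →
      Set.Finite {y : subgroupH1 (κ.layerSubgroup n) (geomTorsion W (p : ℤ)) |
          W.torsionToPrimaryH1Sub p κ.kerSubgroup
            (resOfLe (geomTorsion W (p : ℤ)) (κ.kerSubgroup_le_layerSubgroup n) y) ∈ W.fineSelmerInfty κ} ∧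
        Nat.card {y : subgroupH1 (κ.layerSubgroup n) (geomTorsion W (p : ℤ)) |
          W.torsionToPrimaryH1Sub p κ.kerSubgroup
            (resOfLe (geomTorsion W (p : ℤ)) (κ.kerSubgroup_le_layerSubgroup n) y) ∈ W.fineSelmerInfty κ} <
          p ^ p ^ n) :
    ConjAAt W p :=
  conjAAt_of_irr_of_not_surj_of_forall_natCard_layerResidual_lt W p hX.irr hns n h

end Doors

end Summit.BirchSwinnertonDyer.BirchSwinnertonDyer.Theorems.UpperNonSurjThreeSharp

end
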